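import Literature.AnabelianGeometry.SemiGraphs.TemperedDeltaCompletion
import Literature.AnabelianGeometry.SemiGraphs.TemperedOrigin
import Literature.IUT.HodgeTheaters.StableCurveTemperedDataOfSpecialFibre
import HarnessLib

/-!
# [SemiAnbd] Lemma 6.1 (iii) «follows immediately from assertion (ii)» — `N_{Π_{X_K}}(Π^temp) = Π^temp` from `N_{Δ_X}(Δ^temp) = Δ^temp`

Mochizuki, *Semi-graphs of anabelioids*, Publ. RIMS **42** (2006) [SemiAnbd], §6, Lemma 6.1 (Profinite
Normalizers), author's manuscript p. 69: «(ii) We have: `N_{Δ_X}(Δ^temp_X) = Δ^temp_X`. (iii) We have: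
`N_{Π_{X_K}}(Π^temp_{X_K}) = Π^temp_{X_K}`.  Proof. Assertion (i) (respectively, (ii)) is the content of
[André], Lemma 3.2.1 (respectively, [André], Corollary 6.2.2). Assertion (iii) follows immediately from
assertion (ii).» [cite: MochizukiSemiAnbd2006, Lem 6.1(ii)-(iii) p.69]

PROOF-ONLY companion of `TemperedOrigin.lean` / `TemperedAnabelian.lean` (abc-iut cell, block F
fact-proving wave, seat abc-iut-f-174, FACT-LIST row F-1706 `TemperedOrigin.ProfiniteNormalizersHolds`;
theorems only — no `def`, no `instance`, no new named fact).  The tree proves the typed Lemma 6.1 (ii)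
AND (iii) (`X.DeltaTempNormallyTerminal`, `X.PiTempNormallyTerminal`) separately from the André TOWER
input `htower₀` (abc-iut-w5-d139 / w5-d240: `deltaTempNormallyTerminal_of_tower`,
`piTempNormallyTerminal_of_tower`, hence `TemperedOrigin.profiniteNormalizersHolds_of_tower`).  This file
types the printed proof sentence itself: **(iii) is DERIVED from (ii)** — so that the row F-1706 is reduced
to its single cited input [André] Cor. 6.2.2 (= the typed (ii), carried as the binder
`X.DeltaTempNormallyTerminal`) plus the exactness `Ker(Π_{X_K} → G_K) = Δ_X`, which is a THEOREM for
tempered, Galois-countable `X` (`TemperedCurve.ker_augHat_eq_deltaHat_of_isTempered`, abc-iut-w5-d139).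

The derivation (p. 69 «immediately»): let `g ∈ Π_{X_K}` normalise `ι(Π^temp)`.  Since
`augHat(Π_{X_K}) = G_K = aug(Π^temp)` (the tree's `StableCurveTemperedData.OfSpecialFibre.augHat_mem_GK`: dense image + `G_K` closed), pick `t ∈ Π^temp`
with `augHat g = aug t`; then `h := g · ι(t)⁻¹ ∈ Ker(augHat) = Δ_X` still normalises `ι(Π^temp)`, hence
normalises `ι(Π^temp) ∩ Δ_X = ι(Δ^temp)` (`range_toHat_inf_ker_augHat`) inside `Δ_X`, so `h ∈ ι(Δ^temp)`
by (ii), and `g = h · ι(t) ∈ ι(Π^temp)`.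

Results: `TemperedCurve.piTempNormallyTerminal_of_deltaTempNormallyTerminal` ((ii) + exactness ⇒ (iii)),
`profiniteNormalizers_of_deltaTempNormallyTerminal` (`IsTempered`, first countable) /
`profiniteNormalizers_of_deltaTempNormallyTerminal_of_groupLevelData` (`d : X.GroupLevelData`), and the
origin-quantified `TemperedOrigin.profiniteNormalizersHolds_of_deltaTempNormallyTerminal` — F-1706 from
«`Π^temp` tempered + Galois-countable + [André] Cor. 6.2.2 for the certified curves».

HONEST FRAMING.  [André] Cor. 6.2.2 (= Lemma 6.1 (ii)) is the INPUT, not proved here; classical topological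
group theory only; nothing here concerns the disputed parts of inter-universal Teichmüller theory or takes a
side on [IUTchIII] Cor. 3.12; typed ≠ proved.
-/

noncomputable section

namespace Literature.AnabelianGeometry.SemiGraphs

namespace TemperedCurve

open _root_.Topology

variable {p : ℕ} [Fact p.Prime] (X : TemperedCurve p)

/-! ### `augHat(Π_{X_K}) = G_K = aug(Π^temp_{X_K})` -/

/-- Every `g ∈ Π_{X_K}` has the same image in `G_K` as some `t ∈ Π^temp_{X_K}`
(`augHat(Π_{X_K}) ⊆ G_K` is the tree lemma `IUT.HodgeTheaters.StableCurveTemperedData.OfSpecialFibre.augHat_mem_GK`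
— dense image + `G_K` closed — and `G_K = aug(Π^temp)` is `range_aug`). [cite: MochizukiSemiAnbd2006, §6 p.69] -/
theorem exists_aug_eq_augHat (g : X.PiHat) : ∃ t : X.PiTemp, X.aug t = X.augHat g := by
  have h : X.augHat g ∈ X.aug.toMonoidHom.range := by
    rw [X.range_aug]
    exact Literature.IUT.HodgeTheaters.StableCurveTemperedData.OfSpecialFibre.augHat_mem_GK X g
  obtain ⟨t, ht⟩ := h
  exact ⟨t, ht⟩

/-- `ι(Π^temp_{X_K}) ∩ Ker(Π_{X_K} → G_K) = ι(Δ^temp_X)` (from `augHat ∘ ι = aug`).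
[cite: MochizukiSemiAnbd2006, §6 p.69] -/
theorem range_toHat_inf_ker_augHat :
    X.toHat.toMonoidHom.range ⊓ X.augHat.toMonoidHom.ker = X.DeltaTemp.map X.toHat.toMonoidHom := by
  ext y
  constructor
  · intro hy
    obtain ⟨⟨t, rfl⟩, hk⟩ := Subgroup.mem_inf.mp hy
    have hk' : X.augHat (X.toHat t) = 1 := hk
    rw [X.augHat_comp] at hk'
    exact ⟨t, hk', rfl⟩
  · rintro ⟨t, ht, rfl⟩
    have ht' : X.aug t = 1 := ht
    refine Subgroup.mem_inf.mpr ⟨⟨t, rfl⟩, ?_⟩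
    change X.augHat (X.toHat t) = 1
    rw [X.augHat_comp, ht']

/-! ### Lemma 6.1 (iii) from Lemma 6.1 (ii) -/

/-- **[SemiAnbd] Lemma 6.1 (iii) «follows immediately from assertion (ii)»** (p. 69): given the
exactness `Ker(Π_{X_K} → G_K) = Δ_X` of the completed sequence and Lemma 6.1 (ii)
`N_{Δ_X}(Δ^temp_X) = Δ^temp_X` (the typed `X.DeltaTempNormallyTerminal`; print: [André] Cor. 6.2.2), the
image of `Π^temp_{X_K}` is its own normaliser in `Π_{X_K}` (the typed `X.PiTempNormallyTerminal`).  Proof: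
a normalising `g` is corrected by some `ι(t)`, `t ∈ Π^temp`, into `Ker(augHat) = Δ_X`, where it
normalises `ι(Π^temp) ∩ Δ_X = ι(Δ^temp)` and hence lies in `ι(Δ^temp)` by (ii).
[cite: MochizukiSemiAnbd2006, Lem 6.1(iii) p.69] -/
theorem piTempNormallyTerminal_of_deltaTempNormallyTerminal
    (hker : X.augHat.toMonoidHom.ker = X.DeltaHat) (hii : X.DeltaTempNormallyTerminal) :
    X.PiTempNormallyTerminal := by
  refine le_antisymm ?_ Subgroup.le_normalizer
  intro g hg
  rw [Subgroup.mem_normalizer_iff] at hg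
  -- correct `g` by an element of `Π^temp` with the same image in `G_K`
  obtain ⟨t, ht⟩ := X.exists_aug_eq_augHat g
  set h : X.PiHat := g * (X.toHat t)⁻¹ with hh_def
  have hιt : X.toHat t ∈ X.toHat.toMonoidHom.range := ⟨t, rfl⟩
  -- `h` normalises `ι(Π^temp)`
  have hnorm : h ∈ Subgroup.normalizer (X.toHat.toMonoidHom.range : Set X.PiHat) := by
    have hg' : g ∈ Subgroup.normalizer (X.toHat.toMonoidHom.range : Set X.PiHat) :=
      Subgroup.mem_normalizer_iff.mpr hg
    exact Subgroup.mul_mem _ hg' (Subgroup.inv_mem _ (Subgroup.le_normalizer hιt))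
  -- `h ∈ Ker(augHat) = Δ_X`
  have hker_h : h ∈ X.augHat.toMonoidHom.ker := by
    rw [MonoidHom.mem_ker]
    change X.augHat (g * (X.toHat t)⁻¹) = 1
    rw [map_mul, map_inv, X.augHat_comp, ht, mul_inv_cancel]
  have hΔ : h ∈ X.DeltaHat := hker ▸ hker_h
  -- inside `Δ_X`, `h` normalises `ι(Δ^temp) = ι(Π^temp) ∩ Δ_X`
  have hnormΔ : (⟨h, hΔ⟩ : X.DeltaHat) ∈ Subgroup.normalizer
      (((X.DeltaTemp.map X.toHat.toMonoidHom).subgroupOf X.DeltaHat : Subgroup X.DeltaHat) :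
        Set X.DeltaHat) := by
    rw [Subgroup.mem_normalizer_iff]
    intro n
    rw [Subgroup.mem_subgroupOf, Subgroup.mem_subgroupOf, ← range_toHat_inf_ker_augHat,
      Subgroup.mem_inf, Subgroup.mem_inf]
    have hn : (n : X.PiHat) ∈ X.augHat.toMonoidHom.ker := hker.symm ▸ n.2
    have hcn : ((⟨h, hΔ⟩ : X.DeltaHat) * n * (⟨h, hΔ⟩ : X.DeltaHat)⁻¹ : X.DeltaHat).1 ∈
        X.augHat.toMonoidHom.ker :=
      hker.symm ▸ ((⟨h, hΔ⟩ : X.DeltaHat) * n * (⟨h, hΔ⟩ : X.DeltaHat)⁻¹).2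
    have key := (Subgroup.mem_normalizer_iff.mp hnorm) (n : X.PiHat)
    constructor
    · rintro ⟨hn1, -⟩
      exact ⟨key.mp hn1, hcn⟩
    · rintro ⟨hc1, -⟩
      exact ⟨key.mpr hc1, hn⟩
  -- Lemma 6.1 (ii): the normaliser is `ι(Δ^temp)` itself
  have hmem : (⟨h, hΔ⟩ : X.DeltaHat) ∈
      ((X.DeltaTemp.map X.toHat.toMonoidHom).subgroupOf X.DeltaHat : Subgroup X.DeltaHat) := by
    have h' := hnormΔ
    rw [hii] at h'
    exact h'
  rw [Subgroup.mem_subgroupOf] at hmem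
  obtain ⟨s, -, hs⟩ := hmem
  -- `g = h · ι(t) ∈ ι(Π^temp)`
  have hg_eq : g = h * X.toHat t := by rw [hh_def, inv_mul_cancel_right]
  rw [hg_eq]
  exact Subgroup.mul_mem _ ⟨s, hs⟩ hιt

/-- **[SemiAnbd] Lemma 6.1 (ii) ∧ (iii)** — the `X`-instance of the FACT-LIST row
`TemperedOrigin.ProfiniteNormalizersHolds` — for a tempered, Galois-countable `X` (`IsTempered X.PiTemp`,
first countability suffices) from Lemma 6.1 (ii) ALONE (= [André] Cor. 6.2.2, the binder `hii`): the
exactness `Ker(Π_{X_K} → G_K) = Δ_X` is the tree theorem `ker_augHat_eq_deltaHat_of_isTempered` and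
(iii) follows from (ii) (`piTempNormallyTerminal_of_deltaTempNormallyTerminal`).
[cite: MochizukiSemiAnbd2006, Lem 6.1(ii)-(iii) p.69] -/
theorem profiniteNormalizers_of_deltaTempNormallyTerminal (hT : IsTempered X.PiTemp)
    [FirstCountableTopology X.PiTemp] (hii : X.DeltaTempNormallyTerminal) :
    X.DeltaTempNormallyTerminal ∧ X.PiTempNormallyTerminal :=
  ⟨hii, X.piTempNormallyTerminal_of_deltaTempNormallyTerminal
    (X.ker_augHat_eq_deltaHat_of_isTempered hT) hii⟩

/-- **[SemiAnbd] Lemma 6.1 (ii) ∧ (iii)** for `X` carrying the parameter bundle `d : X.GroupLevelData`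
(ruling η′: `Π^temp` tempered, Galois-countable, …) from Lemma 6.1 (ii) alone (= [André] Cor. 6.2.2).
[cite: MochizukiSemiAnbd2006, Lem 6.1(ii)-(iii) p.69] -/
theorem profiniteNormalizers_of_deltaTempNormallyTerminal_of_groupLevelData (d : X.GroupLevelData)
    (hii : X.DeltaTempNormallyTerminal) :
    X.DeltaTempNormallyTerminal ∧ X.PiTempNormallyTerminal :=
  ⟨hii, X.piTempNormallyTerminal_of_deltaTempNormallyTerminal (X.ker_augHat_eq_deltaHat d) hii⟩

end TemperedCurve

namespace TemperedOrigin

variable {p : ℕ} [Fact p.Prime]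

/-- **[SemiAnbd] Lemma 6.1 (ii), (iii) as printed** (origin-quantified; the FACT-LIST row F-1706
`Ω.ProfiniteNormalizersHolds`, input of Thm. 6.6 via `profiniteOuterIsoLiftsHolds_of`) REDUCED TO ITS
PRINTED INPUT: it holds as soon as every certified curve has `Π^temp` tempered ([SemiAnbd] Def. 3.1 (i))
and Galois-countable ([IUTchI] Rmk. 2.5.3 (i); first countable suffices) and satisfies Lemma 6.1 (ii)
`N_{Δ_X}(Δ^temp_X) = Δ^temp_X` — «the content of [André], Corollary 6.2.2» — assertion (iii) being
DERIVED («follows immediately from assertion (ii)», p. 69).  The origin certificate is necessary (the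
universal closure over all `Ω` is refuted in the tree); [André] Cor. 6.2.2 is not proved here.
[cite: MochizukiSemiAnbd2006, Lem 6.1(ii)-(iii) p.69] -/
theorem profiniteNormalizersHolds_of_deltaTempNormallyTerminal (Ω : TemperedOrigin p)
    (h : ∀ X : TemperedCurve p, Ω.IsHyperbolicCurveOrigin X →
      IsTempered X.PiTemp ∧ FirstCountableTopology X.PiTemp ∧ X.DeltaTempNormallyTerminal) :
    Ω.ProfiniteNormalizersHolds := fun X hX => by
  obtain ⟨hT, hfc, hii⟩ := h X hX
  haveI := hfc
  exact X.profiniteNormalizers_of_deltaTempNormallyTerminal hT hii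

/-- **[SemiAnbd] Lemma 6.1 (ii), (iii) as printed** from the parameter bundle `GroupLevelData` of the
certified curves and Lemma 6.1 (ii) (= [André] Cor. 6.2.2) alone.
[cite: MochizukiSemiAnbd2006, Lem 6.1(ii)-(iii) p.69] -/
theorem profiniteNormalizersHolds_of_groupLevelData_of_deltaTempNormallyTerminal (Ω : TemperedOrigin p)
    (h : ∀ X : TemperedCurve p, Ω.IsHyperbolicCurveOrigin X →
      Nonempty X.GroupLevelData ∧ X.DeltaTempNormallyTerminal) :
    Ω.ProfiniteNormalizersHolds := fun X hX => by
  obtain ⟨⟨d⟩, hii⟩ := h X hX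
  exact X.profiniteNormalizers_of_deltaTempNormallyTerminal_of_groupLevelData d hii

end TemperedOrigin

end Literature.AnabelianGeometry.SemiGraphs

end

-- build-queue re-enqueue (comment-only re-land by abc-iut-w4-d014 g7, 2026-08-26T10:4xZ): declarations byte-identical to the
-- accepted tree copy (sha16 7b03662eeb876004); purpose: produce the missing olean (stranded accept) so that PENDING children deferred «no-olean» can verify.
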